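import Literature.NumberTheory.Rogawski1990.KottwitzSignArchCongruence      -- ★ (T-d) FILE 3: `archKappaOrbitalIntegral_kottwitzSignArchWeight_transport_archCongr`; brings FILE 2 + ★ `archStableOrbitalIntegral_classWeight_mul`
import Literature.NumberTheory.Rogawski1990.ArchSplitRationalWallTorusPoint  -- ★ (m2): `exists_eq_conj_diagonal_of_split`∕`_of_charpoly`, `isConj_coe_cmRationalToArch_coe_archDiagTorus`, `isStablyConj_archCongr_of_isConj_coe`
import HarnessLib

/-!
# The SIGNED singular stable orbital integral `Φ^{st,e}(γ₀ ⊗ 1, f)` of a split rational element, read on a DIAGONAL carrier at its WALL TORUS POINT: both sides of (ST-∞) land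
# at the same `t(z⁰)`, `z⁰_w = (σ_w a, σ_w b, σ_w a)` ((R1-i-c) of the (ST-∞) dress; Rogawski 1990 §4.1 (4.1.1)–(4.1.2), §3.8 Prop. 3.8.1 (a), §14.2 p. 232, §14.4 p. 237)

Topic `NumberTheory/Rogawski1990`; namespace `Literature.NumberTheory.Rogawski1990`.  THEOREMS ONLY (no `def`, no instance, no notation, no axiom, no named fact, no `sorry`).
Cell `pub/hodgecm-mathlib`, ENGINE T1 (crux H413 = `stmt-HodgeConjecture-24833`); floor-2 road «(J-nc) in-house», brick (R1-i-c) of R1 «(L-use) at all indefinite places» (LEAD F0P3a-plan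
(g9) WORDS T8-119∕T8-120, LEAD-HANDOFF g9 §6 (4)); author F0P3a-p07 (g8), 2026-09-01.

WHY.  The closer's (ST-∞) clause (★ `SingularEllipticTransferCanonical`, the `PinSingularArchInnerTransfer` socket) reads, for a smooth (14.2.1)-pair `(a′, a)` and rational `γ₀ ↔ γ` with
`(γ₀ − e₁)(γ₀ − e₂) = 0`, `e₁ ≠ e₂`: `Φ^{st}_{H′}(γ₀ ⊗ 1, (e∘⟦·⟧)·a′; m_{G′,s}) = Φ^{st}_{Φ₃}(γ ⊗ 1, (e∘⟦·⟧)·a; m_{G,s})`.  The R1 engine (★ p842366 ∕ (R1-i-a)) proves the signed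
identity on the DIAGONAL carriers `U(diag α)`, `U(diag β)` at a common WALL torus point `t(z⁰)`.  This file moves both sides of (ST-∞) there: (i) `Φ^{st}` with a class weight on the function
is ★ `archKappaOrbitalIntegral` (★ `archStableOrbitalIntegral_classWeight_mul`) and the signed sum is carried by every congruence `g ↦ T g T⁻¹` with transported measures (★ (T-d) FILE 3
`archKappaOrbitalIntegral_kottwitzSignArchWeight_transport_archCongr`); (ii) `Φ^{st}(·, f)` sees only the stable class (★ `stableOrbitalIntegralRel_congr`; stable conjugacy on the `arch`
carriers is `GL₃(L ⊗ ℝ)`-conjugacy, an equivalence relation); (iii) ★ (m2): after any congruence to a diagonal carrier, `γ₀ ⊗ 1` (non-central) is stably conjugate to `t(z⁰)`,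
`z⁰_w = (σ_w a, σ_w b, σ_w a)` with `{a, b} = {e₁, e₂}`, `charpoly γ₀ = (X − a)²(X − b)`; and `γ ⊗ 1 ↔ γ₀ ⊗ 1` (`IsConj` pushed along `GL₃(mixedEmbedding)`) lands at the SAME `t(z⁰)` on the
second diagonal carrier (★ `isConj_coe_cmRationalToArch_coe_archDiagTorus` is carrier-blind).

WHAT IS PROVED.
* §1 `archStableOrbitalIntegral_eq_of_isStablyConj` (any `N`, `H`): `Φ^{st}_H(γ, f; m) = Φ^{st}_H(δ, f; m)` for `γ ∼_st δ`.
* §2 `archStableOrbitalIntegral_kottwitzSignArchWeight_mul_transport_archCongr` (any `N`; congruence `Φ : U(H₂) ≃ₜ* U(H)`, `g ↦ T g T⁻¹`, `(c⊗1)(T)ᵀ (H⊗1) T = H₂⊗1`): IN THE CLOSER'S CURRENCY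
  `Φ^{st}_H(Φ γ, (e_H∘⟦·⟧)·(f ∘ Φ⁻¹); Φ_* m) = Φ^{st}_{H₂}(γ, (e_{H₂}∘⟦·⟧)·f; m)`.
* §3 **`archStableOrbitalIntegral_signed_cmRationalToArch_eq_archDiagTorus_wall`** (`H′` hermitian anisotropic, `Ψ : U(H′) ≃ₜ* U(diag α′)` a congruence by `S`, `γ₀` non-central with
  `(γ₀ − e₁)(γ₀ − e₂) = 0`, `e₁ ≠ e₂`, `charpoly γ₀ = (X − e₁)²(X − e₂)`):
  `Φ^{st}_{H′}(γ₀ ⊗ 1, (e∘⟦·⟧)·f; m) = Φ^{st}_{diag α′}(t(z⁰), (e∘⟦·⟧)·(f ∘ Ψ⁻¹); Ψ_* m)`, `z⁰_w = (σ_w e₁, σ_w e₂, σ_w e₁)`.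
* §4 **`archStableOrbitalIntegral_signed_cmRationalToArch_eq_archDiagTorus_wall_of_corresponds`**: the same for ANY second form `H₂` (e.g. `Φ₃`), `γ ∈ U(H₂)(L⁺)` with `γ₀ ↔ γ`, and a
  congruence `Φ_A : U(H₂) ≃ₜ* U(diag β)` by `T_A`: `Φ^{st}_{H₂}(γ ⊗ 1, (e∘⟦·⟧)·f; m) = Φ^{st}_{diag β}(t(z⁰), (e∘⟦·⟧)·(f ∘ Φ_A⁻¹); (Φ_A)_* m)` — the SAME `z⁰`.
* §5 **`exists_wall_archStableOrbitalIntegral_signed_eq_archDiagTorus_of_corresponds`** — the (ST-∞)-SHAPED PACKAGE (no charpoly binder): for non-central `γ₀` there are `{a, b} = {e₁, e₂}`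
  with `c(a)a = c(b)b = 1`, `charpoly γ₀ = (X − a)²(X − b)`, the wall shape `z⁰_w 0 = z⁰_w 2 ≠ z⁰_w 1` (★ p841776's `hwall`), and BOTH readings (§3 for `H′ → diag α′`, §4 for `H₂ → diag β`)
  at `t(z⁰)`, `z⁰_w = (σ_w a, σ_w b, σ_w a)` — so (ST-∞) at `(γ₀, γ)` IS the two-diagonal-carrier identity of ★ p842366 ∕ (R1-i-a) at `z0 := z⁰` for the transported families and functions.
HONEST LABEL: HC_CM is proved only modulo the 7 printed citations until rung 0 closes; this file is bookkeeping over ★ cell files and pays nothing by itself.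

## References
* [Rogawski1990] J. D. Rogawski, *Automorphic Representations of Unitary Groups in Three Variables*, Ann. of Math. Stud. 123 (1990), §4.1 (4.1.1)–(4.1.2) pp. 39–40, §3.8 Prop. 3.8.1 (a)
  p. 27, §3.1 p. 19, §8.2 p. 117, §14.2 (14.2.1) p. 232, §14.4 p. 237.
* [BorelJacquet1979] A. Borel, H. Jacquet, *Automorphic forms and automorphic representations*, PSPM 33.1 (1979), §4.1.
* [PlatonovRapinchuk1994] V. Platonov, A. Rapinchuk, *Algebraic Groups and Number Theory* (1994), §2.3.
-/

set_option autoImplicit false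

noncomputable section

open MeasureTheory NumberField NumberField.InfinitePlace NumberField.mixedEmbedding Matrix Polynomial
open scoped MatrixGroups

namespace Literature.NumberTheory.Rogawski1990

open Literature.MeasureTheory.Group Literature.NumberTheory.Automorphic
open Literature.NumberTheory.Automorphic.UnitaryGroup hiding hermForm
open Literature.AlgebraicGeometry.ShimuraVarieties (unitaryGroup hermForm)

/-! ## §1 `Φ^{st}` on the `arch` carriers is a stable-class function -/

section StableClass

variable (L : Type) [Field L] [NumberField L] [IsCMField L] (N : ℕ) (H : Matrix (Fin N) (Fin N) L)
  [∀ γ : arch (↥(maximalRealSubfield L)) L (IsCMField.complexConj L) N H,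
    MeasurableSpace (arch (↥(maximalRealSubfield L)) L (IsCMField.complexConj L) N H ⧸ Subgroup.centralizer ({γ} : Set (arch (↥(maximalRealSubfield L)) L (IsCMField.complexConj L) N H)))]

/-- **`Φ^{st}_H(γ, f; m) = Φ^{st}_H(δ, f; m)` for `γ ∼_st δ`** (`GL_N(L ⊗ ℝ)`-conjugacy is an equivalence relation, so the index sets of (4.1.1) coincide; ★ `stableOrbitalIntegralRel_congr`).
[cite: Rogawski1990, §4.1 (4.1.1) p. 40; §3.1 p. 19] -/
theorem archStableOrbitalIntegral_eq_of_isStablyConj (m : OrbitalMeasureFamily (arch (↥(maximalRealSubfield L)) L (IsCMField.complexConj L) N H))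
    (f : arch (↥(maximalRealSubfield L)) L (IsCMField.complexConj L) N H → ℂ) {γ δ : arch (↥(maximalRealSubfield L)) L (IsCMField.complexConj L) N H}
    (h : IsStablyConj (conjMixed (↥(maximalRealSubfield L)) L (IsCMField.complexConj L)) (archFormOf L N H) γ δ) :
    archStableOrbitalIntegral L N H m f γ = archStableOrbitalIntegral L N H m f δ :=
  stableOrbitalIntegralRel_congr (G := arch (↥(maximalRealSubfield L)) L (IsCMField.complexConj L) N H) (fun _ => ⟨fun h1 => h.symm.trans h1, fun h2 => h.trans h2⟩) m f

end StableClass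

/-! ## §2 The signed sum in the closer's currency `(e ∘ ⟦·⟧) · f` under a congruence -/

section Signed

variable (L : Type) [Field L] [NumberField L] [IsCMField L] {N : ℕ} {H H₂ : Matrix (Fin N) (Fin N) L} (T : GL (Fin N) (mixedSpace L))
  (Φ : arch (↥(maximalRealSubfield L)) L (IsCMField.complexConj L) N H₂ ≃ₜ* arch (↥(maximalRealSubfield L)) L (IsCMField.complexConj L) N H)
  (hΦ : ∀ g : arch (↥(maximalRealSubfield L)) L (IsCMField.complexConj L) N H₂,
    ((Φ g : arch (↥(maximalRealSubfield L)) L (IsCMField.complexConj L) N H) : GL (Fin N) (mixedSpace L)) = T * (g : GL (Fin N) (mixedSpace L)) * T⁻¹)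
  (hT : formCongr (conjMixed (↥(maximalRealSubfield L)) L (IsCMField.complexConj L)) T (archFormOf L N H) = archFormOf L N H₂)
  [∀ γ : arch (↥(maximalRealSubfield L)) L (IsCMField.complexConj L) N H,
    MeasurableSpace (arch (↥(maximalRealSubfield L)) L (IsCMField.complexConj L) N H ⧸ Subgroup.centralizer ({γ} : Set (arch (↥(maximalRealSubfield L)) L (IsCMField.complexConj L) N H)))]
  [∀ γ : arch (↥(maximalRealSubfield L)) L (IsCMField.complexConj L) N H,
    BorelSpace (arch (↥(maximalRealSubfield L)) L (IsCMField.complexConj L) N H ⧸ Subgroup.centralizer ({γ} : Set (arch (↥(maximalRealSubfield L)) L (IsCMField.complexConj L) N H)))]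
  [∀ γ : arch (↥(maximalRealSubfield L)) L (IsCMField.complexConj L) N H₂,
    MeasurableSpace (arch (↥(maximalRealSubfield L)) L (IsCMField.complexConj L) N H₂ ⧸ Subgroup.centralizer ({γ} : Set (arch (↥(maximalRealSubfield L)) L (IsCMField.complexConj L) N H₂)))]
  [∀ γ : arch (↥(maximalRealSubfield L)) L (IsCMField.complexConj L) N H₂,
    BorelSpace (arch (↥(maximalRealSubfield L)) L (IsCMField.complexConj L) N H₂ ⧸ Subgroup.centralizer ({γ} : Set (arch (↥(maximalRealSubfield L)) L (IsCMField.complexConj L) N H₂)))]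

include hΦ hT in
/-- **`Φ^{st}_H(Φ γ, (e_H∘⟦·⟧)·(f ∘ Φ⁻¹); Φ_* m) = Φ^{st}_{H₂}(γ, (e_{H₂}∘⟦·⟧)·f; m)`** — ★ FILE 3's signed transport spelled with the weight ON THE FUNCTION, as (ST-∞) writes it
(★ `archStableOrbitalIntegral_classWeight_mul` on both sides). [cite: Rogawski1990, §4.1 (4.1.2) p. 39; §14.4 p. 237] -/
theorem archStableOrbitalIntegral_kottwitzSignArchWeight_mul_transport_archCongr
    (m : OrbitalMeasureFamily (arch (↥(maximalRealSubfield L)) L (IsCMField.complexConj L) N H₂)) (f : arch (↥(maximalRealSubfield L)) L (IsCMField.complexConj L) N H₂ → ℂ)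
    (γ : arch (↥(maximalRealSubfield L)) L (IsCMField.complexConj L) N H₂) :
    archStableOrbitalIntegral L N H (m.transport Φ.toMulEquiv Φ.continuous Φ.symm.continuous)
        (fun x => kottwitzSignArchWeight L N H (ConjClasses.mk x) * (f ∘ Φ.symm) x) (Φ γ) =
      archStableOrbitalIntegral L N H₂ m (fun x => kottwitzSignArchWeight L N H₂ (ConjClasses.mk x) * f x) γ := by
  rw [archStableOrbitalIntegral_classWeight_mul, archStableOrbitalIntegral_classWeight_mul]
  exact archKappaOrbitalIntegral_kottwitzSignArchWeight_transport_archCongr L T Φ hΦ hT m f γ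

end Signed

/-! ## §3–§5 Both sides of (ST-∞) at the wall torus point -/

section WallInner

variable (L : Type) [Field L] [NumberField L] [IsCMField L] (H' : Matrix (Fin 3) (Fin 3) L)
variable (α' : Fin 3 → L) (S : GL (Fin 3) (mixedSpace L))
  (Ψ : arch (↥(maximalRealSubfield L)) L (IsCMField.complexConj L) 3 H' ≃ₜ* arch (↥(maximalRealSubfield L)) L (IsCMField.complexConj L) 3 (Matrix.diagonal α'))
  (hΨ : ∀ g : arch (↥(maximalRealSubfield L)) L (IsCMField.complexConj L) 3 H',
    ((Ψ g : arch (↥(maximalRealSubfield L)) L (IsCMField.complexConj L) 3 (Matrix.diagonal α')) : GL (Fin 3) (mixedSpace L)) = S * (g : GL (Fin 3) (mixedSpace L)) * S⁻¹)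
  (hS : formCongr (conjMixed (↥(maximalRealSubfield L)) L (IsCMField.complexConj L)) S (archFormOf L 3 (Matrix.diagonal α')) = archFormOf L 3 H')
  [∀ γ : arch (↥(maximalRealSubfield L)) L (IsCMField.complexConj L) 3 H',
    MeasurableSpace (arch (↥(maximalRealSubfield L)) L (IsCMField.complexConj L) 3 H' ⧸ Subgroup.centralizer ({γ} : Set (arch (↥(maximalRealSubfield L)) L (IsCMField.complexConj L) 3 H')))]
  [∀ γ : arch (↥(maximalRealSubfield L)) L (IsCMField.complexConj L) 3 H',
    BorelSpace (arch (↥(maximalRealSubfield L)) L (IsCMField.complexConj L) 3 H' ⧸ Subgroup.centralizer ({γ} : Set (arch (↥(maximalRealSubfield L)) L (IsCMField.complexConj L) 3 H')))]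
  [∀ γ : arch (↥(maximalRealSubfield L)) L (IsCMField.complexConj L) 3 (Matrix.diagonal α'),
    MeasurableSpace (arch (↥(maximalRealSubfield L)) L (IsCMField.complexConj L) 3 (Matrix.diagonal α') ⧸
      Subgroup.centralizer ({γ} : Set (arch (↥(maximalRealSubfield L)) L (IsCMField.complexConj L) 3 (Matrix.diagonal α'))))]
  [∀ γ : arch (↥(maximalRealSubfield L)) L (IsCMField.complexConj L) 3 (Matrix.diagonal α'),
    BorelSpace (arch (↥(maximalRealSubfield L)) L (IsCMField.complexConj L) 3 (Matrix.diagonal α') ⧸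
      Subgroup.centralizer ({γ} : Set (arch (↥(maximalRealSubfield L)) L (IsCMField.complexConj L) 3 (Matrix.diagonal α'))))]

include hΨ hS in
/-- **§3 `Φ^{st}_{H′}(γ₀ ⊗ 1, (e∘⟦·⟧)·f; m) = Φ^{st}_{diag α′}(t(z⁰), (e∘⟦·⟧)·(f ∘ Ψ⁻¹); Ψ_* m)`**, `z⁰_w = (σ_w e₁, σ_w e₂, σ_w e₁)`, for `H′` hermitian anisotropic and `γ₀` non-central with
`(γ₀ − e₁)(γ₀ − e₂) = 0`, `e₁ ≠ e₂`, `charpoly γ₀ = (X − e₁)²(X − e₂)` (§2, then §1 at ★ (m2) `exists_isStablyConj_cmRationalToArch_archDiagTorus_wall`; the unimodularity proofs `h₁ h₂` only name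
the point). [cite: Rogawski1990, §4.1 (4.1.1)–(4.1.2) pp. 39–40; §3.8 Prop. 3.8.1 p. 27; §14.2 p. 232; §14.4 p. 237] -/
theorem archStableOrbitalIntegral_signed_cmRationalToArch_eq_archDiagTorus_wall (hherm : (H'.map (cmConjRingHom L))ᵀ = H')
    (hanis : ∀ x : Fin 3 → L, hermForm (cmConjRingHom L) H' x x = 0 → x = 0) (γ₀ : (cmDatum L 3 H').Rational) {e₁ e₂ : L} (he : e₁ ≠ e₂)
    (hsplit : ((((γ₀ : unitaryGroup (cmConjRingHom L) H').val : GL (Fin 3) L) : Matrix (Fin 3) (Fin 3) L) - e₁ • (1 : Matrix (Fin 3) (Fin 3) L)) *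
      ((((γ₀ : unitaryGroup (cmConjRingHom L) H').val : GL (Fin 3) L) : Matrix (Fin 3) (Fin 3) L) - e₂ • (1 : Matrix (Fin 3) (Fin 3) L)) = 0)
    (hnc : ¬ ∃ ζ : L, (((γ₀ : unitaryGroup (cmConjRingHom L) H').val : GL (Fin 3) L) : Matrix (Fin 3) (Fin 3) L) = ζ • (1 : Matrix (Fin 3) (Fin 3) L))
    (hχ : (((γ₀ : unitaryGroup (cmConjRingHom L) H').val : GL (Fin 3) L) : Matrix (Fin 3) (Fin 3) L).charpoly = (X - C e₁) ^ 2 * (X - C e₂))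
    (h₁ : (IsCMField.complexConj L e₁ : L) * e₁ = 1) (h₂ : (IsCMField.complexConj L e₂ : L) * e₂ = 1)
    (m : OrbitalMeasureFamily (arch (↥(maximalRealSubfield L)) L (IsCMField.complexConj L) 3 H')) (f : arch (↥(maximalRealSubfield L)) L (IsCMField.complexConj L) 3 H' → ℂ) :
    archStableOrbitalIntegral L 3 H' m (fun x => kottwitzSignArchWeight L 3 H' (ConjClasses.mk x) * f x) (cmRationalToArch L 3 H' γ₀) =
      archStableOrbitalIntegral L 3 (Matrix.diagonal α') (m.transport Ψ.toMulEquiv Ψ.continuous Ψ.symm.continuous)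
        (fun x => kottwitzSignArchWeight L 3 (Matrix.diagonal α') (ConjClasses.mk x) * (f ∘ Ψ.symm) x)
        (archDiagTorus L 3 α' fun w =>
          ![(⟨w.1.embedding e₁, mem_sphere_zero_iff_norm.mpr (norm_embedding_eq_one_of_complexConj_mul_self L e₁ h₁ w)⟩ : Circle),
            ⟨w.1.embedding e₂, mem_sphere_zero_iff_norm.mpr (norm_embedding_eq_one_of_complexConj_mul_self L e₂ h₂ w)⟩,
            ⟨w.1.embedding e₁, mem_sphere_zero_iff_norm.mpr (norm_embedding_eq_one_of_complexConj_mul_self L e₁ h₁ w)⟩]) := by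
  obtain ⟨h₁', h₂', hst⟩ := exists_isStablyConj_cmRationalToArch_archDiagTorus_wall L H' α' S Ψ hΨ hherm hanis γ₀ he hsplit hnc hχ
  rw [← archStableOrbitalIntegral_kottwitzSignArchWeight_mul_transport_archCongr L S Ψ hΨ hS m f (cmRationalToArch L 3 H' γ₀)]
  exact archStableOrbitalIntegral_eq_of_isStablyConj L 3 (Matrix.diagonal α') _ _ hst

end WallInner

section WallSecond

variable (L : Type) [Field L] [NumberField L] [IsCMField L] (H' : Matrix (Fin 3) (Fin 3) L)
variable {H₂ : Matrix (Fin 3) (Fin 3) L} (β : Fin 3 → L) (T_A : GL (Fin 3) (mixedSpace L))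
  (Φ_A : arch (↥(maximalRealSubfield L)) L (IsCMField.complexConj L) 3 H₂ ≃ₜ* arch (↥(maximalRealSubfield L)) L (IsCMField.complexConj L) 3 (Matrix.diagonal β))
  (hΦ_A : ∀ g : arch (↥(maximalRealSubfield L)) L (IsCMField.complexConj L) 3 H₂,
    ((Φ_A g : arch (↥(maximalRealSubfield L)) L (IsCMField.complexConj L) 3 (Matrix.diagonal β)) : GL (Fin 3) (mixedSpace L)) = T_A * (g : GL (Fin 3) (mixedSpace L)) * T_A⁻¹)
  (hT_A : formCongr (conjMixed (↥(maximalRealSubfield L)) L (IsCMField.complexConj L)) T_A (archFormOf L 3 (Matrix.diagonal β)) = archFormOf L 3 H₂)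
  [∀ γ : arch (↥(maximalRealSubfield L)) L (IsCMField.complexConj L) 3 H₂,
    MeasurableSpace (arch (↥(maximalRealSubfield L)) L (IsCMField.complexConj L) 3 H₂ ⧸ Subgroup.centralizer ({γ} : Set (arch (↥(maximalRealSubfield L)) L (IsCMField.complexConj L) 3 H₂)))]
  [∀ γ : arch (↥(maximalRealSubfield L)) L (IsCMField.complexConj L) 3 H₂,
    BorelSpace (arch (↥(maximalRealSubfield L)) L (IsCMField.complexConj L) 3 H₂ ⧸ Subgroup.centralizer ({γ} : Set (arch (↥(maximalRealSubfield L)) L (IsCMField.complexConj L) 3 H₂)))]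
  [∀ γ : arch (↥(maximalRealSubfield L)) L (IsCMField.complexConj L) 3 (Matrix.diagonal β),
    MeasurableSpace (arch (↥(maximalRealSubfield L)) L (IsCMField.complexConj L) 3 (Matrix.diagonal β) ⧸
      Subgroup.centralizer ({γ} : Set (arch (↥(maximalRealSubfield L)) L (IsCMField.complexConj L) 3 (Matrix.diagonal β))))]
  [∀ γ : arch (↥(maximalRealSubfield L)) L (IsCMField.complexConj L) 3 (Matrix.diagonal β),
    BorelSpace (arch (↥(maximalRealSubfield L)) L (IsCMField.complexConj L) 3 (Matrix.diagonal β) ⧸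
      Subgroup.centralizer ({γ} : Set (arch (↥(maximalRealSubfield L)) L (IsCMField.complexConj L) 3 (Matrix.diagonal β))))]

include hΦ_A hT_A in
/-- **§4 `Φ^{st}_{H₂}(γ ⊗ 1, (e∘⟦·⟧)·f; m) = Φ^{st}_{diag β}(t(z⁰), (e∘⟦·⟧)·(f ∘ Φ_A⁻¹); (Φ_A)_* m)` AT THE SAME `z⁰`** for every rational correspondent `γ₀ ↔ γ ∈ U(H₂)(L⁺)` (ANY second
form `H₂`, e.g. `Φ₃`; `H′` hermitian anisotropic carries `γ₀` as in §3) and every congruence `Φ_A : U(H₂) ≃ₜ* U(diag β)`: `γ ⊗ 1 ↔ γ₀ ⊗ 1 ∼ t_β(z⁰)` in `GL₃(L ⊗ ℝ)` (★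
`isConj_coe_cmRationalToArch_coe_archDiagTorus` is carrier-blind), then §2 and §1. [cite: Rogawski1990, §4.1 (4.1.1)–(4.1.2) pp. 39–40; §3.8 Prop. 3.8.1 p. 27; §14.2 p. 232; §14.4 p. 237]
[cite: BorelJacquet1979, §4.1] -/
theorem archStableOrbitalIntegral_signed_cmRationalToArch_eq_archDiagTorus_wall_of_corresponds (hherm : (H'.map (cmConjRingHom L))ᵀ = H')
    (hanis : ∀ x : Fin 3 → L, hermForm (cmConjRingHom L) H' x x = 0 → x = 0) (γ₀ : (cmDatum L 3 H').Rational) {e₁ e₂ : L} (he : e₁ ≠ e₂)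
    (hsplit : ((((γ₀ : unitaryGroup (cmConjRingHom L) H').val : GL (Fin 3) L) : Matrix (Fin 3) (Fin 3) L) - e₁ • (1 : Matrix (Fin 3) (Fin 3) L)) *
      ((((γ₀ : unitaryGroup (cmConjRingHom L) H').val : GL (Fin 3) L) : Matrix (Fin 3) (Fin 3) L) - e₂ • (1 : Matrix (Fin 3) (Fin 3) L)) = 0)
    (hnc : ¬ ∃ ζ : L, (((γ₀ : unitaryGroup (cmConjRingHom L) H').val : GL (Fin 3) L) : Matrix (Fin 3) (Fin 3) L) = ζ • (1 : Matrix (Fin 3) (Fin 3) L))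
    (hχ : (((γ₀ : unitaryGroup (cmConjRingHom L) H').val : GL (Fin 3) L) : Matrix (Fin 3) (Fin 3) L).charpoly = (X - C e₁) ^ 2 * (X - C e₂))
    (h₁ : (IsCMField.complexConj L e₁ : L) * e₁ = 1) (h₂ : (IsCMField.complexConj L e₂ : L) * e₂ = 1)
    (γ : (cmDatum L 3 H₂).Rational)
    (hcorr : Corresponds (cmConjRingHom L) H' H₂ (γ₀ : unitaryGroup (cmConjRingHom L) H') (γ : unitaryGroup (cmConjRingHom L) H₂))
    (m : OrbitalMeasureFamily (arch (↥(maximalRealSubfield L)) L (IsCMField.complexConj L) 3 H₂)) (f : arch (↥(maximalRealSubfield L)) L (IsCMField.complexConj L) 3 H₂ → ℂ) :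
    archStableOrbitalIntegral L 3 H₂ m (fun x => kottwitzSignArchWeight L 3 H₂ (ConjClasses.mk x) * f x) (cmRationalToArch L 3 H₂ γ) =
      archStableOrbitalIntegral L 3 (Matrix.diagonal β) (m.transport Φ_A.toMulEquiv Φ_A.continuous Φ_A.symm.continuous)
        (fun x => kottwitzSignArchWeight L 3 (Matrix.diagonal β) (ConjClasses.mk x) * (f ∘ Φ_A.symm) x)
        (archDiagTorus L 3 β fun w =>
          ![(⟨w.1.embedding e₁, mem_sphere_zero_iff_norm.mpr (norm_embedding_eq_one_of_complexConj_mul_self L e₁ h₁ w)⟩ : Circle),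
            ⟨w.1.embedding e₂, mem_sphere_zero_iff_norm.mpr (norm_embedding_eq_one_of_complexConj_mul_self L e₂ h₂ w)⟩,
            ⟨w.1.embedding e₁, mem_sphere_zero_iff_norm.mpr (norm_embedding_eq_one_of_complexConj_mul_self L e₁ h₁ w)⟩]) := by
  obtain ⟨Q, -, -, hγ⟩ := exists_eq_conj_diagonal_of_charpoly L H' hherm hanis (γ₀ : unitaryGroup (cmConjRingHom L) H') he hsplit hnc hχ
  -- `γ ⊗ 1 ↔ γ₀ ⊗ 1` in `GL₃(L ⊗ ℝ)` (`IsConj` pushed along `GL₃(mixedEmbedding)`), and `γ₀ ⊗ 1 ∼ t_β(z⁰)`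
  have h0 : IsConj ((cmRationalToArch L 3 H' γ₀ : arch (↥(maximalRealSubfield L)) L (IsCMField.complexConj L) 3 H') : GL (Fin 3) (mixedSpace L))
      ((cmRationalToArch L 3 H₂ γ : arch (↥(maximalRealSubfield L)) L (IsCMField.complexConj L) 3 H₂) : GL (Fin 3) (mixedSpace L)) :=
    (Matrix.GeneralLinearGroup.map (mixedEmbedding L)).map_isConj hcorr
  have hc := h0.symm.trans (isConj_coe_cmRationalToArch_coe_archDiagTorus L H' β γ₀ Q hγ
    (fun w => ![(⟨w.1.embedding e₁, mem_sphere_zero_iff_norm.mpr (norm_embedding_eq_one_of_complexConj_mul_self L e₁ h₁ w)⟩ : Circle),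
      ⟨w.1.embedding e₂, mem_sphere_zero_iff_norm.mpr (norm_embedding_eq_one_of_complexConj_mul_self L e₂ h₂ w)⟩,
      ⟨w.1.embedding e₁, mem_sphere_zero_iff_norm.mpr (norm_embedding_eq_one_of_complexConj_mul_self L e₁ h₁ w)⟩])
    fun w i => by fin_cases i <;> rfl)
  rw [← archStableOrbitalIntegral_kottwitzSignArchWeight_mul_transport_archCongr L T_A Φ_A hΦ_A hT_A m f (cmRationalToArch L 3 H₂ γ)]
  exact archStableOrbitalIntegral_eq_of_isStablyConj L 3 (Matrix.diagonal β) _ _ (isStablyConj_archCongr_of_isConj_coe L H₂ β T_A Φ_A hΦ_A hc)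

end WallSecond

section WallBoth

variable (L : Type) [Field L] [NumberField L] [IsCMField L] (H' : Matrix (Fin 3) (Fin 3) L)
variable (α' : Fin 3 → L) (S : GL (Fin 3) (mixedSpace L))
  (Ψ : arch (↥(maximalRealSubfield L)) L (IsCMField.complexConj L) 3 H' ≃ₜ* arch (↥(maximalRealSubfield L)) L (IsCMField.complexConj L) 3 (Matrix.diagonal α'))
  (hΨ : ∀ g : arch (↥(maximalRealSubfield L)) L (IsCMField.complexConj L) 3 H',
    ((Ψ g : arch (↥(maximalRealSubfield L)) L (IsCMField.complexConj L) 3 (Matrix.diagonal α')) : GL (Fin 3) (mixedSpace L)) = S * (g : GL (Fin 3) (mixedSpace L)) * S⁻¹)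
  (hS : formCongr (conjMixed (↥(maximalRealSubfield L)) L (IsCMField.complexConj L)) S (archFormOf L 3 (Matrix.diagonal α')) = archFormOf L 3 H')
  [∀ γ : arch (↥(maximalRealSubfield L)) L (IsCMField.complexConj L) 3 H',
    MeasurableSpace (arch (↥(maximalRealSubfield L)) L (IsCMField.complexConj L) 3 H' ⧸ Subgroup.centralizer ({γ} : Set (arch (↥(maximalRealSubfield L)) L (IsCMField.complexConj L) 3 H')))]
  [∀ γ : arch (↥(maximalRealSubfield L)) L (IsCMField.complexConj L) 3 H',
    BorelSpace (arch (↥(maximalRealSubfield L)) L (IsCMField.complexConj L) 3 H' ⧸ Subgroup.centralizer ({γ} : Set (arch (↥(maximalRealSubfield L)) L (IsCMField.complexConj L) 3 H')))]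
  [∀ γ : arch (↥(maximalRealSubfield L)) L (IsCMField.complexConj L) 3 (Matrix.diagonal α'),
    MeasurableSpace (arch (↥(maximalRealSubfield L)) L (IsCMField.complexConj L) 3 (Matrix.diagonal α') ⧸
      Subgroup.centralizer ({γ} : Set (arch (↥(maximalRealSubfield L)) L (IsCMField.complexConj L) 3 (Matrix.diagonal α'))))]
  [∀ γ : arch (↥(maximalRealSubfield L)) L (IsCMField.complexConj L) 3 (Matrix.diagonal α'),
    BorelSpace (arch (↥(maximalRealSubfield L)) L (IsCMField.complexConj L) 3 (Matrix.diagonal α') ⧸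
      Subgroup.centralizer ({γ} : Set (arch (↥(maximalRealSubfield L)) L (IsCMField.complexConj L) 3 (Matrix.diagonal α'))))]
variable {H₂ : Matrix (Fin 3) (Fin 3) L} (β : Fin 3 → L) (T_A : GL (Fin 3) (mixedSpace L))
  (Φ_A : arch (↥(maximalRealSubfield L)) L (IsCMField.complexConj L) 3 H₂ ≃ₜ* arch (↥(maximalRealSubfield L)) L (IsCMField.complexConj L) 3 (Matrix.diagonal β))
  (hΦ_A : ∀ g : arch (↥(maximalRealSubfield L)) L (IsCMField.complexConj L) 3 H₂,
    ((Φ_A g : arch (↥(maximalRealSubfield L)) L (IsCMField.complexConj L) 3 (Matrix.diagonal β)) : GL (Fin 3) (mixedSpace L)) = T_A * (g : GL (Fin 3) (mixedSpace L)) * T_A⁻¹)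
  (hT_A : formCongr (conjMixed (↥(maximalRealSubfield L)) L (IsCMField.complexConj L)) T_A (archFormOf L 3 (Matrix.diagonal β)) = archFormOf L 3 H₂)
  [∀ γ : arch (↥(maximalRealSubfield L)) L (IsCMField.complexConj L) 3 H₂,
    MeasurableSpace (arch (↥(maximalRealSubfield L)) L (IsCMField.complexConj L) 3 H₂ ⧸ Subgroup.centralizer ({γ} : Set (arch (↥(maximalRealSubfield L)) L (IsCMField.complexConj L) 3 H₂)))]
  [∀ γ : arch (↥(maximalRealSubfield L)) L (IsCMField.complexConj L) 3 H₂,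
    BorelSpace (arch (↥(maximalRealSubfield L)) L (IsCMField.complexConj L) 3 H₂ ⧸ Subgroup.centralizer ({γ} : Set (arch (↥(maximalRealSubfield L)) L (IsCMField.complexConj L) 3 H₂)))]
  [∀ γ : arch (↥(maximalRealSubfield L)) L (IsCMField.complexConj L) 3 (Matrix.diagonal β),
    MeasurableSpace (arch (↥(maximalRealSubfield L)) L (IsCMField.complexConj L) 3 (Matrix.diagonal β) ⧸
      Subgroup.centralizer ({γ} : Set (arch (↥(maximalRealSubfield L)) L (IsCMField.complexConj L) 3 (Matrix.diagonal β))))]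
  [∀ γ : arch (↥(maximalRealSubfield L)) L (IsCMField.complexConj L) 3 (Matrix.diagonal β),
    BorelSpace (arch (↥(maximalRealSubfield L)) L (IsCMField.complexConj L) 3 (Matrix.diagonal β) ⧸
      Subgroup.centralizer ({γ} : Set (arch (↥(maximalRealSubfield L)) L (IsCMField.complexConj L) 3 (Matrix.diagonal β))))]

include hΨ hS hΦ_A hT_A in
/-- **§5 THE (ST-∞)-SHAPED PACKAGE: BOTH SIDES AT ONE WALL TORUS POINT.**  For `H′` hermitian anisotropic, `γ₀ ∈ U(H′)(L⁺)` NON-CENTRAL with `(γ₀ − e₁)(γ₀ − e₂) = 0`, `e₁ ≠ e₂`, a rational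
correspondent `γ₀ ↔ γ ∈ U(H₂)(L⁺)`, and congruences `Ψ : U(H′) ≃ₜ* U(diag α′)`, `Φ_A : U(H₂) ≃ₜ* U(diag β)`: there is the ordering `{a, b} = {e₁, e₂}` (plane eigenvalue `a`) with `c(a)a = c(b)b = 1`,
`charpoly γ₀ = (X − a)²(X − b)`, the WALL SHAPE `z⁰_w 0 = z⁰_w 2 ≠ z⁰_w 1` of `z⁰_w = (σ_w a, σ_w b, σ_w a)` (★ p841776's `hwall`), and
`Φ^{st}_{H′}(γ₀ ⊗ 1, (e∘⟦·⟧)·f′; m′) = Φ^{st}_{diag α′}(t(z⁰), (e∘⟦·⟧)·(f′ ∘ Ψ⁻¹); Ψ_* m′)`, `Φ^{st}_{H₂}(γ ⊗ 1, (e∘⟦·⟧)·f; m) = Φ^{st}_{diag β}(t(z⁰), (e∘⟦·⟧)·(f ∘ Φ_A⁻¹); (Φ_A)_* m)` — so (ST-∞) at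
`(γ₀, γ)` is EXACTLY the two-diagonal-carrier identity of ★ `prod_mul_archStableOrbitalIntegral_kottwitzSign_eq_of_regular_eq_of_clause` (p842366) ∕ (R1-i-a) at `z0 := z⁰` for the transported
data. [cite: Rogawski1990, §4.1 (4.1.1)–(4.1.2) pp. 39–40; §3.8 Prop. 3.8.1 p. 27; §8.2 p. 117; §14.2 p. 232; §14.4 p. 237] [cite: BorelJacquet1979, §4.1] -/
theorem exists_wall_archStableOrbitalIntegral_signed_eq_archDiagTorus_of_corresponds (hherm : (H'.map (cmConjRingHom L))ᵀ = H')
    (hanis : ∀ x : Fin 3 → L, hermForm (cmConjRingHom L) H' x x = 0 → x = 0) (γ₀ : (cmDatum L 3 H').Rational) {e₁ e₂ : L} (he : e₁ ≠ e₂)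
    (hsplit : ((((γ₀ : unitaryGroup (cmConjRingHom L) H').val : GL (Fin 3) L) : Matrix (Fin 3) (Fin 3) L) - e₁ • (1 : Matrix (Fin 3) (Fin 3) L)) *
      ((((γ₀ : unitaryGroup (cmConjRingHom L) H').val : GL (Fin 3) L) : Matrix (Fin 3) (Fin 3) L) - e₂ • (1 : Matrix (Fin 3) (Fin 3) L)) = 0)
    (hnc : ¬ ∃ ζ : L, (((γ₀ : unitaryGroup (cmConjRingHom L) H').val : GL (Fin 3) L) : Matrix (Fin 3) (Fin 3) L) = ζ • (1 : Matrix (Fin 3) (Fin 3) L))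
    (γ : (cmDatum L 3 H₂).Rational)
    (hcorr : Corresponds (cmConjRingHom L) H' H₂ (γ₀ : unitaryGroup (cmConjRingHom L) H') (γ : unitaryGroup (cmConjRingHom L) H₂))
    (m' : OrbitalMeasureFamily (arch (↥(maximalRealSubfield L)) L (IsCMField.complexConj L) 3 H')) (f' : arch (↥(maximalRealSubfield L)) L (IsCMField.complexConj L) 3 H' → ℂ)
    (m : OrbitalMeasureFamily (arch (↥(maximalRealSubfield L)) L (IsCMField.complexConj L) 3 H₂)) (f : arch (↥(maximalRealSubfield L)) L (IsCMField.complexConj L) 3 H₂ → ℂ) :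
    ∃ (a b : L) (ha : (IsCMField.complexConj L a : L) * a = 1) (hb : (IsCMField.complexConj L b : L) * b = 1), ((a = e₁ ∧ b = e₂) ∨ (a = e₂ ∧ b = e₁)) ∧
      (((γ₀ : unitaryGroup (cmConjRingHom L) H').val : GL (Fin 3) L) : Matrix (Fin 3) (Fin 3) L).charpoly = (X - C a) ^ 2 * (X - C b) ∧
      (∀ w : {w : InfinitePlace L // IsComplex w},
        ![(⟨w.1.embedding a, mem_sphere_zero_iff_norm.mpr (norm_embedding_eq_one_of_complexConj_mul_self L a ha w)⟩ : Circle),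
            ⟨w.1.embedding b, mem_sphere_zero_iff_norm.mpr (norm_embedding_eq_one_of_complexConj_mul_self L b hb w)⟩,
            ⟨w.1.embedding a, mem_sphere_zero_iff_norm.mpr (norm_embedding_eq_one_of_complexConj_mul_self L a ha w)⟩] 0 =
          ![(⟨w.1.embedding a, mem_sphere_zero_iff_norm.mpr (norm_embedding_eq_one_of_complexConj_mul_self L a ha w)⟩ : Circle),
            ⟨w.1.embedding b, mem_sphere_zero_iff_norm.mpr (norm_embedding_eq_one_of_complexConj_mul_self L b hb w)⟩,
            ⟨w.1.embedding a, mem_sphere_zero_iff_norm.mpr (norm_embedding_eq_one_of_complexConj_mul_self L a ha w)⟩] 2 ∧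
        ![(⟨w.1.embedding a, mem_sphere_zero_iff_norm.mpr (norm_embedding_eq_one_of_complexConj_mul_self L a ha w)⟩ : Circle),
            ⟨w.1.embedding b, mem_sphere_zero_iff_norm.mpr (norm_embedding_eq_one_of_complexConj_mul_self L b hb w)⟩,
            ⟨w.1.embedding a, mem_sphere_zero_iff_norm.mpr (norm_embedding_eq_one_of_complexConj_mul_self L a ha w)⟩] 0 ≠
          ![(⟨w.1.embedding a, mem_sphere_zero_iff_norm.mpr (norm_embedding_eq_one_of_complexConj_mul_self L a ha w)⟩ : Circle),
            ⟨w.1.embedding b, mem_sphere_zero_iff_norm.mpr (norm_embedding_eq_one_of_complexConj_mul_self L b hb w)⟩,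
            ⟨w.1.embedding a, mem_sphere_zero_iff_norm.mpr (norm_embedding_eq_one_of_complexConj_mul_self L a ha w)⟩] 1) ∧
      archStableOrbitalIntegral L 3 H' m' (fun x => kottwitzSignArchWeight L 3 H' (ConjClasses.mk x) * f' x) (cmRationalToArch L 3 H' γ₀) =
        archStableOrbitalIntegral L 3 (Matrix.diagonal α') (m'.transport Ψ.toMulEquiv Ψ.continuous Ψ.symm.continuous)
          (fun x => kottwitzSignArchWeight L 3 (Matrix.diagonal α') (ConjClasses.mk x) * (f' ∘ Ψ.symm) x)
          (archDiagTorus L 3 α' fun w =>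
            ![(⟨w.1.embedding a, mem_sphere_zero_iff_norm.mpr (norm_embedding_eq_one_of_complexConj_mul_self L a ha w)⟩ : Circle),
              ⟨w.1.embedding b, mem_sphere_zero_iff_norm.mpr (norm_embedding_eq_one_of_complexConj_mul_self L b hb w)⟩,
              ⟨w.1.embedding a, mem_sphere_zero_iff_norm.mpr (norm_embedding_eq_one_of_complexConj_mul_self L a ha w)⟩]) ∧
      archStableOrbitalIntegral L 3 H₂ m (fun x => kottwitzSignArchWeight L 3 H₂ (ConjClasses.mk x) * f x) (cmRationalToArch L 3 H₂ γ) =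
        archStableOrbitalIntegral L 3 (Matrix.diagonal β) (m.transport Φ_A.toMulEquiv Φ_A.continuous Φ_A.symm.continuous)
          (fun x => kottwitzSignArchWeight L 3 (Matrix.diagonal β) (ConjClasses.mk x) * (f ∘ Φ_A.symm) x)
          (archDiagTorus L 3 β fun w =>
            ![(⟨w.1.embedding a, mem_sphere_zero_iff_norm.mpr (norm_embedding_eq_one_of_complexConj_mul_self L a ha w)⟩ : Circle),
              ⟨w.1.embedding b, mem_sphere_zero_iff_norm.mpr (norm_embedding_eq_one_of_complexConj_mul_self L b hb w)⟩,
              ⟨w.1.embedding a, mem_sphere_zero_iff_norm.mpr (norm_embedding_eq_one_of_complexConj_mul_self L a ha w)⟩]) := by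
  have hne₁ : (((γ₀ : unitaryGroup (cmConjRingHom L) H').val : GL (Fin 3) L) : Matrix (Fin 3) (Fin 3) L) ≠ e₁ • (1 : Matrix (Fin 3) (Fin 3) L) := fun h => hnc ⟨e₁, h⟩
  have hne₂ : (((γ₀ : unitaryGroup (cmConjRingHom L) H').val : GL (Fin 3) L) : Matrix (Fin 3) (Fin 3) L) ≠ e₂ • (1 : Matrix (Fin 3) (Fin 3) L) := fun h => hnc ⟨e₂, h⟩
  obtain ⟨a, b, -, hab, ha, hb, -, hχ⟩ := exists_eq_conj_diagonal_of_split L H' hherm hanis (γ₀ : unitaryGroup (cmConjRingHom L) H') he hsplit hne₁ hne₂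
  have hab' : a ≠ b := by
    rcases hab with ⟨ha1, hb1⟩ | ⟨ha1, hb1⟩
    · rw [ha1, hb1]; exact he
    · rw [ha1, hb1]; exact he.symm
  have hsplit' : ((((γ₀ : unitaryGroup (cmConjRingHom L) H').val : GL (Fin 3) L) : Matrix (Fin 3) (Fin 3) L) - a • (1 : Matrix (Fin 3) (Fin 3) L)) *
      ((((γ₀ : unitaryGroup (cmConjRingHom L) H').val : GL (Fin 3) L) : Matrix (Fin 3) (Fin 3) L) - b • (1 : Matrix (Fin 3) (Fin 3) L)) = 0 := by
    rcases hab with ⟨ha1, hb1⟩ | ⟨ha1, hb1⟩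
    · rw [ha1, hb1]; exact hsplit
    · rw [ha1, hb1, ← hsplit]
      have hX1 : Commute (((γ₀ : unitaryGroup (cmConjRingHom L) H').val : GL (Fin 3) L) : Matrix (Fin 3) (Fin 3) L)
          ((((γ₀ : unitaryGroup (cmConjRingHom L) H').val : GL (Fin 3) L) : Matrix (Fin 3) (Fin 3) L) - e₁ • (1 : Matrix (Fin 3) (Fin 3) L)) :=
        (Commute.refl _).sub_right ((Commute.one_right _).smul_right e₁)
      have hE : Commute (e₂ • (1 : Matrix (Fin 3) (Fin 3) L))
          ((((γ₀ : unitaryGroup (cmConjRingHom L) H').val : GL (Fin 3) L) : Matrix (Fin 3) (Fin 3) L) - e₁ • (1 : Matrix (Fin 3) (Fin 3) L)) :=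
        ((Commute.one_left _).smul_left e₂).sub_right (((Commute.one_left (1 : Matrix (Fin 3) (Fin 3) L)).smul_left e₂).smul_right e₁)
      exact (hX1.sub_left hE).eq
  have ha' : cmConjRingHom L a * a = 1 := ha
  have hb' : cmConjRingHom L b * b = 1 := hb
  refine ⟨a, b, ha, hb, hab, hχ, fun w => archDiagTorus_wall_coords L hab' ha hb w,
    archStableOrbitalIntegral_signed_cmRationalToArch_eq_archDiagTorus_wall L H' α' S Ψ hΨ hS hherm hanis γ₀ hab' hsplit' hnc hχ ha hb m' f',
    archStableOrbitalIntegral_signed_cmRationalToArch_eq_archDiagTorus_wall_of_corresponds L H' β T_A Φ_A hΦ_A hT_A hherm hanis γ₀ hab' hsplit' hnc hχ ha hb γ hcorr m f⟩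

end WallBoth

end Literature.NumberTheory.Rogawski1990

end
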